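import Summits.BirchSwinnertonDyer.BirchSwinnertonDyer.Theorems.PrintCFramBottomClassIndexLawFiveLeEisensteinKolyvaginSideEndState
import Summits.BirchSwinnertonDyer.BirchSwinnertonDyer.Theorems.PrintCFramBottomClassIndexLawFiveLeEisensteinAnalyticTrivialLocus
import Summits.BirchSwinnertonDyer.BirchSwinnertonDyer.Theorems.PrintCFramBottomClassIndexLawFiveLeEisensteinEndStatePrints7
import HarnessLib

/-!
# Route `PrintCFram`, crux C2 `BottomClassIndexLawFiveLe` (stmt-BirchSwinnertonDyer-20372), line `eisenstein-resource-bdp-line`: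
# the REGULAR LOCUS needs NO main conjecture — `BSD_p(W)` and the crux's conclusion for `W` from control, the rank-zero
# twist and ONE number: `ord_p log_ω(y_K) = v_p(c)`
# (cell `bsd-print-cfram`, width seat `bsd-line-cfram-p1-w4` g0; helper `--supports` 20372; THEOREMS ONLY, 0 defs, 0 facts)

HONEST FRAMING. Nothing about BSD is proved unconditionally; the crux is NOT closed. On this line the crux is fed to the
row kernel `bsdp_of_flatIMCEq_of_control_of_twist_row` through the ♭-(∅,0) IMC EQUALITY at every frame, cut into β1
(Eisenstein inclusion) and (AN); the companion `…KolyvaginSideEndState` (p628271) showed β1 ⟸ UPPER ∧ (AN′). THIS FILE observes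
that on the REGULAR LOCUS — a frame at which the characteristic power series of `X_(∅,0)(W/K_∞)` has `ord_p f(0) = 0`
(`XAc.HasCharValuationAt … 0`; e.g. both character residual Selmer groups trivial, w2 g3's p628104 situation, §2) — NEITHER
inclusion of the main conjecture is needed at all: the two index sockets of the kernel (`IndexLowerBoundLeAt`, STEP L, and
`Upper.IndexUpperBoundLeAt`, co-STEP L, at the Manin slack `v_p(c)`) follow from the control EQUALITY at that frame together
with the single numerical statement `ord_p log_{ω_W}(P) = v_p(c)` about the Heegner point `P` (`X11b.padicLogOrd`), because the
sockets `AdditiveIMCLowerBDPOnTreeLeAt` / `Upper.AdditiveIMCUpperBDPOnTreeLeAt` read `2·ord_p log ≤ n + 2s` / `n + 2s ≤ 2·ord_p log`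
with `n = ord_p f(0) = 0`. No ♭-BDP frame, no Hsieh / Liu–Zhang–Zhang input, no Λ-adic congruence enters.

* §1 (generic, any globally minimal `W/ℚ` of analytic rank one, any odd `p ∣ N`, ONE Heegner datum with `d_K` odd `< −4`,
  `L(W^{(d_K)},1) ≠ 0`): `bsdp_of_charValuationZero_of_control_of_padicLogOrd` — `BSD_p(W)` ⟸ `ToricPublishedInputs` ∧ a
  regular frame ∧ control at it ∧ `v_p(c) ≤ ord_p log_ω P ≤ v_p(c)` ∧ `BSD_p` of a minimal model of the twist;
  `hasCharValuationAt_zero_of_isTorsion_of_mu_eq_zero_of_lambda_eq_zero` — a frame is regular as soon as `X` is torsion with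
  `μ = λ = 0` (characteristic generator `p^μ g₀`, `ord ḡ₀ = λ`, Washington §13.2).
* §2 (the CM-ramified class of the crux): `hasCharValuationAt_zero_cmRamified_of_trivial_residualSelmer` — the frame `(K'', κ, γ, 𝔭′)`
  is regular as soon as every residual line there with the local clause has TRIVIAL residual Selmer groups (w2 g3's chain:
  `λ = 0` by `LambdaResidualBound`, torsion and `μ = 0` by `isTorsion_and_mu_eq_zero_of_line_devissage`);
  `bsdp_cmRamified_of_regularFrame_of_padicLogOrd` — for `W` CM, `p ≥ 5` CM-ramified, `r_an = 1` and ONE Heegner datum: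
  regular frame ∧ `ord_p log_ω P = v_p(c)` ⟹ `BSD_p(W)` modulo the citations of `stub_prints` (control: the five cohomological
  facts, four of them tree theorems `prints_four_hold`, so only Poitou–Tate for Ш remains displayed; twist: Burungale–Flach +
  modularity); `ramifiedCMBottomClassIndexLawAtZp_of_regularFrame_of_padicLogOrd` — the crux's CONCLUSION
  `X12.O11.RamifiedCMBottomClassIndexLawAtZp W p` for that `W` (k7r-c4 `ramifiedCMBottomClassIndexLawAtZp_of_bsdp`, + Cassels, GZK).
READING. `ord_p log_ω(P) ≤ v_p(c)` is the printed Kriz–Li 2019 shape (Thm. 1.20 / 7.1: at an Eisenstein prime, under the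
Bernoulli-unit condition — which is the «relative p-class numbers trivial» = regular situation of their p. 3 — the normalised
`p`-adic logarithm of the Heegner point is a `p`-adic unit; Rmk. 1.21: CM by `ℚ(√−p)` is the model case; bad reduction at `p`
allowed, LEAD g4 10:55Z (3)); `v_p(c) ≤ ord_p log_ω(P)` is integrality of `log_ω` on `E(K_𝔭)` plus `p ∤ c` (Manin). Both are
DISPLAYED hypotheses here, not named facts: typing Kriz–Li Thm. 1.20 in the tree's `padicLogOrd` currency is a Literature task.
So on the regular locus the crux costs print + one value statement; off it, the line's Λ-adic stubs remain. THEOREMS ONLY; no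
definition, no named fact, no `sorry`. BSD is not proved by any of this; no summit statement is proved by this seat.

References: [KrizLi2019] Thm. 1.20, Rmk. 1.21, p. 3 (doi:10.1017/fms.2019.9); [JetchevSkinnerWan2017] §7.4.1, Thm. 3.3.1
(arXiv:1512.06894); [CastellaGrossiLeeSkinner2022] §3 (arXiv:2008.02571); [GrossZagier1986] I (6.3), (7.3); [Washington1997] §13.2.
-/

set_option autoImplicit false
-- `…BirchSwinnertonDyer.BirchSwinnertonDyer.Theorems…` is the problem's mandated namespace (D-0017).
set_option linter.dupNamespace false

noncomputable section

open scoped Classical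

namespace Summit.BirchSwinnertonDyer.BirchSwinnertonDyer.Theorems.PrintCFram.EisensteinRegularLocus

open WeierstrassCurve NumberField IsDedekindDomain Field PowerSeries IsLocalRing
  Literature.NumberTheory.EllipticCurves Literature.NumberTheory.EllipticCurves.GreenbergSelmer
  Literature.NumberTheory.EllipticCurves.GreenbergVatsal2000
  Literature.NumberTheory.EllipticCurves.ModularForms Literature.NumberTheory.EllipticCurves.Rank1Residual
  Literature.NumberTheory.EllipticCurves.Rank1Residual.Typed IwasawaAlgebra
  Literature.NumberTheory.GaloisRepresentations Literature.NumberTheory.GaloisCohomology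
  Summit.BirchSwinnertonDyer.BirchSwinnertonDyer.Theses.UniversalToricDescent
  Summit.BirchSwinnertonDyer.Rank1Residual Summit.BirchSwinnertonDyer.Rank1Residual.Additive
  Summit.BirchSwinnertonDyer.Rank1Residual.X11b Summit.BirchSwinnertonDyer.Rank1Residual.X11b.AcSelmer
  Summit.BirchSwinnertonDyer.Rank1Residual.X12
  Summit.BirchSwinnertonDyer.Rank1Residual.X2.ResidualDevissageModules
  Summit.BirchSwinnertonDyer.BirchSwinnertonDyer.Theorems
  Summit.BirchSwinnertonDyer.BirchSwinnertonDyer.Theorems.SchneiderFree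
  Summit.BirchSwinnertonDyer.BirchSwinnertonDyer.Theorems.RamifiedSevenEllipticUnits
  Summit.BirchSwinnertonDyer.BirchSwinnertonDyer.Theorems.PrintCFram
  Summit.BirchSwinnertonDyer.BirchSwinnertonDyer.Theorems.PrintCFram.EisensteinResourceBdpLine
  Summit.BirchSwinnertonDyer.BirchSwinnertonDyer.Theorems.PrintCFram.LambdaResidualBound
  Summit.BirchSwinnertonDyer.BirchSwinnertonDyer.Theorems.UniversalToricDescentStrictPlace

/-! ## §1 Generic: on a regular frame the two index sockets are the one number `ord_p log_ω(P) = v_p(c)` -/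

section Generic

variable {p : ℕ} [Fact p.Prime]

/-- **A torsion `Λ`-module with `μ = λ = 0` has the unit characteristic ideal, so its frame is REGULAR** (`ord_p f(0) = 0`
for the generator `f = 1`): `Ch_Λ(X) = (p^{μ} g₀)` with `ord ḡ₀ = λ` (Washington §13.2, tree
`exists_charIdeal_eq_span_C_pow_mu_mul`), and at `μ = λ = 0` the generator `g₀` has a unit constant term, hence is a unit of
`Λ`. Stated for Castella's dual `X_ac^Σ` in the currency `XAc.HasCharValuationAt`. [cite: Washington1997, §13.2] -/
theorem hasCharValuationAt_zero_of_isTorsion_of_mu_eq_zero_of_lambda_eq_zero {K : Type} [Field K] [NumberField K]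
    (E : WeierstrassCurve K) [E.IsElliptic] (κ : ZpExtension K p) (𝔭 : HeightOneSpectrum (𝓞 K))
    {S : Set (HeightOneSpectrum (𝓞 K))} (hS : S.Finite) (γ : absoluteGaloisGroup K) [Fact (κ.IsTopGenerator γ)]
    (htors : Module.IsTorsion (IwasawaAlgebra p) (XAc E p κ 𝔭 S γ)) (hμ : muInvariant p (XAc E p κ 𝔭 S γ) = 0)
    (hl : lambdaInvariant p (XAc E p κ 𝔭 S γ) = 0) : XAc.HasCharValuationAt E p κ 𝔭 S γ 0 := by
  haveI := XAc.module_finite κ 𝔭 S γ hS (W := E)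
  obtain ⟨g₀, hchar, _hg₀, hord⟩ := exists_charIdeal_eq_span_C_pow_mu_mul (p := p) (XAc E p κ 𝔭 S γ) htors
  rw [hμ, pow_zero, map_one, one_mul] at hchar
  rw [hl, Nat.cast_zero] at hord
  have hunit : IsUnit g₀ := PowerSeries.isUnit_iff_constantCoeff.mpr (by
    rw [← PowerSeries.coeff_zero_eq_constantCoeff_apply]
    exact Literature.RingTheory.PowerSeries.isUnit_coeff_of_order_map_residue_eq hord)
  refine ⟨htors, 1, ?_, by rw [map_one]; exact one_ne_zero, by rw [map_one, PadicInt.valuation_one]⟩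
  show Module.charIdeal (IwasawaAlgebra p) (XAc E p κ 𝔭 S γ) = Ideal.span {1}
  rw [hchar, Ideal.span_singleton_one, Ideal.span_singleton_eq_top]
  exact hunit

/-- **`BSD_p` ON A REGULAR FRAME from control and one number (generic, ROW- and DATUM-LOCAL).** `W/ℚ` globally minimal of
analytic rank one, `p` odd with `p ∣ N`, ONE Heegner datum `(N, K, Dt, H, ι, P)` with `d_K` odd, `d_K < −4`,
`L(W^{(d_K)}, 1) ≠ 0`, and ONE anticyclotomic frame `(κ, γ, 𝔭 ∋ p)` of `K` with `𝔭` of degree one. IF (R) the frame is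
regular, `XAc.HasCharValuationAt (W_K) p κ 𝔭 ∅ γ 0` («`ord_p f_ac(0) = 0`»), (C) the control EQUALITY holds there
(`AdditiveControlOnTreeAt`, JSW Thm. 3.3.1 shape), (V) `v_p(c) ≤ ord_p log_{ω_W}(P) ≤ v_p(c)` (`X11b.padicLogOrd` at the
embedding `embAt K p 𝔭`; `c` the constant of `Dt`), and (T) `BSD_p` holds for a globally minimal model of `W^{(d_K)}`, THEN
`BSD_p(W)`. Proof: (R) and the `n` of (C) agree (`HasCharValuationAt.unique`), so (V) is literally the pair of sockets
`AdditiveIMCLowerBDPOnTreeLeAt` / `Upper.AdditiveIMCUpperBDPOnTreeLeAt` at slack `v_p(c)`; the links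
`indexLowerBoundLeAt_of_imcLowerLe_of_control` / `Upper.indexUpperBoundLeAt_of_imcUpperLe_of_control` (Ш finite by Kolyvagin,
the Heegner point non-torsion by Gross–Zagier) give the two index sockets, and `Exact.bsdp_of_exactIndexManin_of_partner_bsdp`
concludes. NO main-conjecture inclusion, NO `p`-adic `L`-function is used. CONDITIONAL on the displayed hypotheses and on
`ToricPublishedInputs` (GZ, Kolyvagin, GZK, modularity, GZ I.7.3, parity, Friedberg–Hoffstein, Heegner points); closes nothing.
[cite: JetchevSkinnerWan2017, §7.4.1 and Thm. 3.3.1 (arXiv:1512.06894 pp. 11, 30)] [cite: GrossZagier1986, Thm. I.(6.3) and (7.3)] -/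
theorem bsdp_of_charValuationZero_of_control_of_padicLogOrd (hp2 : p ≠ 2) (hF : ToricPublishedInputs)
    (W : WeierstrassCurve ℚ) [W.IsElliptic] [W.IsGloballyMinimal] (N : ℕ) [NeZero N] (K : Type) [Field K] [NumberField K]
    (Dt : ModularParametrizationData W N) (H : HeegnerDatum N (NumberField.discr K)) (ι : K →+* ℂ)
    (P : (W.baseChange K).toAffine.Point) (Wd : WeierstrassCurve ℚ) [Wd.IsElliptic] [Wd.IsGloballyMinimal]
    (hr : W.analyticRank = 1) (hN : W.conductorNorm ℤ = N) (hpN : p ∣ N) (hK : IsImaginaryQuadratic K)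
    (hodd : Odd (NumberField.discr K)) (hd4 : NumberField.discr K < -4) (hHH : SatisfiesHeegnerHypothesis N K)
    (hLd : (W.quadraticTwist (NumberField.discr K : ℚ)).entireLFunction 1 ≠ 0)
    (hP : WeierstrassCurve.Affine.Point.map ι.toRatAlgHom P = heegnerPointComplex Dt H)
    (hC : ∃ C : VariableChange ℚ, C • W.quadraticTwist (NumberField.discr K : ℚ) = Wd)
    (κ : ZpExtension K p) (γ : absoluteGaloisGroup K) [Fact (κ.IsTopGenerator γ)]
    (𝔭 : HeightOneSpectrum (𝓞 K)) (h𝔭 : ((p : ℕ) : 𝓞 K) ∈ 𝔭.asIdeal) (he : 𝔭.asIdeal.ramificationIdx (𝓞 ℚ) = 1)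
    (hf : 𝔭.asIdeal.inertiaDeg (𝓞 ℚ) = 1)
    (h0 : XAc.HasCharValuationAt (W.baseChange K) p κ 𝔭 ∅ γ 0)
    (hctl : SchneiderFree.AdditiveControlOnTreeAt p κ 𝔭 γ (embAt K p 𝔭 h𝔭 he hf) P)
    (hlogle : X11b.padicLogOrd W p (embAt K p 𝔭 h𝔭 he hf) P ≤ (padicValNat p Dt.c.natAbs : ℤ))
    (hlogge : (padicValNat p Dt.c.natAbs : ℤ) ≤ X11b.padicLogOrd W p (embAt K p 𝔭 h𝔭 he hf) P)
    (hWd : BSDp Wd p) : BSDp W p := by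
  have hp : p.Prime := Fact.out
  obtain ⟨hGZ, hKo, hGZK, hmod, -, -, hGZ73, -, -, -⟩ := hF
  -- the Heegner point is non-torsion (Gross–Zagier in analytic rank one), so Ш(E/K) is finite (Kolyvagin)
  have hL0 : W.entireLFunction 1 = 0 := entireLFunction_one_eq_zero_of_analyticRank_eq_one hr
  obtain ⟨-, hderiv⟩ := leadingLCoeff_eq_deriv_of_analyticRank_eq_one hr
  haveI hN0 : NeZero (W.conductorNorm ℤ) := ⟨W.conductorNorm_pos_holds.ne'⟩
  have hLK : LDerivEK W K ≠ 0 := by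
    rw [KrizLi2019.lDerivEK_eq_deriv_mul W K hmod hL0]; exact mul_ne_zero hderiv hLd
  have hnt : ¬ IsOfFinAddOrder P :=
    (lDerivEK_ne_zero_iff_not_isOfFinAddOrder W N K (hGZ _ W K) hK hHH ⟨Dt, H, ι, hP⟩).mp hLK
  have hfin : (W.baseChange K).ShaFinite := (hKo N W K hK hHH ⟨Dt, H, ι, hP⟩ hnt).2
  have hw : ¬ p ∣ Units.torsionOrder K := by
    rw [Literature.NumberTheory.QuadraticFields.Quadratic.torsionOrder_eq_two_of_discr_lt_neg_four hK.1 hd4]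
    intro h
    exact hp2 ((Nat.prime_dvd_prime_iff_eq hp Nat.prime_two).mp h)
  -- on the regular frame both sockets at slack `v_p(c)` are the number `ord_p log_ω P = v_p(c)`
  have h1 : SchneiderFree.AdditiveIMCLowerBDPOnTreeLeAt p κ 𝔭 γ (embAt K p 𝔭 h𝔭 he hf) (padicValNat p Dt.c.natAbs) P :=
    ⟨0, h0, by omega⟩
  have h2 : SchneiderFree.Upper.AdditiveIMCUpperBDPOnTreeLeAt p κ 𝔭 γ (embAt K p 𝔭 h𝔭 he hf)
      (padicValNat p Dt.c.natAbs) P :=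
    ⟨0, h0, by omega⟩
  have hlo : SchneiderFree.IndexLowerBoundLeAt W p K P (padicValNat p Dt.c.natAbs) :=
    SchneiderFreeAdditiveX3.indexLowerBoundLeAt_of_imcLowerLe_of_control hN hK hHH hfin h1 hctl
  have hup : SchneiderFree.Upper.IndexUpperBoundLeAt W p K P (padicValNat p Dt.c.natAbs) :=
    SchneiderFree.Upper.indexUpperBoundLeAt_of_imcUpperLe_of_control hN hK hHH hfin h2 hctl
  exact SchneiderFree.Exact.bsdp_of_exactIndexManin_of_partner_bsdp hGZ hKo hGZK hmod hGZ73 W p N K Dt H ι P Wd hr hN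
    hpN hK hodd hw hHH hLd hP hC hp2 hlo hup hWd

end Generic

/-! ## §2 On the CM-ramified class of the crux: regular frames, `BSD_p`, and the crux's conclusion for `W` -/

section CMRamified

variable {p : ℕ} [Fact p.Prime]

/-- **A frame of the CM-ramified class is REGULAR as soon as the character residual Selmer groups there are trivial.** For `W/ℚ`
globally minimal CM, `p ≥ 5` CM-ramified, a Heegner field `K''` of `N_W`, an anticyclotomic frame `(κ, γ, 𝔭′ ∋ p)`: IF every
`Γ_{K''}`-stable `Φ ≤ W[p]` with no non-zero `ker κ ⊓ D_{𝔭′}`-fixed vector in `W[p]/Φ` has TRIVIAL residual Selmer groups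
`R_{𝔭′}^S(K''_∞, Φ)`, `R_{𝔭′}^S(K''_∞, W[p]/Φ)` at the bad set `S` (w2 g3's regular-locus hypothesis, p628104), THEN
`X_(∅,0)(W/K''_∞)` at `𝔭′` has `ord_p f(0) = 0`. Chain: the residual line of the rational `p`-isogeny (LEAD g4 `RationalPIsogeny`,
`IsogenyLineData`), (L) from `W(ℚ_p)[p] = 0` (k7r + X11b), Brink (Literature); then `λ = 0`
(`pow_lambdaInvariant_empty_le_mul_natCard_residualSelmer_of_line`), torsion and `μ = 0`
(`isTorsion_and_mu_eq_zero_of_line_devissage`), and §1. No named fact. [cite: CastellaGrossiLeeSkinner2022, §3 Thm. 3.2.1 and Props. 17, 18 (arXiv:2008.02571)]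
[cite: KrizLi2019, p. 3 («relative p-class numbers … trivial»)] -/
theorem hasCharValuationAt_zero_cmRamified_of_trivial_residualSelmer (W : WeierstrassCurve ℚ) [W.IsElliptic]
    [W.IsGloballyMinimal] (hCM : W.HasCM) (hram : CMRamified W p) (h5 : 5 ≤ p) {N : ℕ} {K : Type} [Field K] [NumberField K]
    (hN : W.conductorNorm ℤ = N) (hK : IsImaginaryQuadratic K) (hHN : SatisfiesHeegnerHypothesis N K)
    (κ : ZpExtension K p) (γ : absoluteGaloisGroup K) [Fact (κ.IsTopGenerator γ)]
    (𝔭' : HeightOneSpectrum (𝓞 K)) (h𝔭' : ((p : ℕ) : 𝓞 K) ∈ 𝔭'.asIdeal)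
    (htriv : ∀ (Φ : X2.ResidualDevissageModules.StableSubgroup (absoluteGaloisGroup K) ((W.baseChange K).geomTorsion (p : ℤ))),
      (∀ y : Φ.Quot, (∀ g : ↥(κ.kerSubgroup ⊓ decomp 𝔭'), g • y = y) → y = 0) →
      Nat.card (datumStrictSelmer κ.kerSubgroup Φ.Sub p (AcSelmer.bdpData Φ.Sub p 𝔭')
          {v : HeightOneSpectrum (𝓞 K) | ¬ (W.baseChange K).HasGoodReductionAt v ∧ ((p : ℕ) : 𝓞 K) ∉ v.asIdeal}) = 1 ∧
      Nat.card (datumStrictSelmer κ.kerSubgroup Φ.Quot p (AcSelmer.bdpData Φ.Quot p 𝔭')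
          {v : HeightOneSpectrum (𝓞 K) | ¬ (W.baseChange K).HasGoodReductionAt v ∧ ((p : ℕ) : 𝓞 K) ∉ v.asIdeal}) = 1) :
    XAc.HasCharValuationAt (W.baseChange K) p κ 𝔭' ∅ γ 0 := by
  haveI hEK : (W.baseChange K).IsElliptic := inferInstanceAs (W.map (algebraMap ℚ K)).IsElliptic
  have hpr : p.Prime := Fact.out
  have hp2 : p ≠ 2 := by omega
  have hadd : Addv W p := addv_of_cmRamified W hCM hram h5
  have hpN : p ∣ N := by
    rw [← hN]; exact (W.dvd_conductorNorm_iff_not_hasGoodReductionAtPrime p).mpr hadd.1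
  obtain ⟨he', hf'⟩ := degreeOne_of_dvd_of_heegner hK hHN hpN h𝔭'
  have hW := prime_nsmul_eq_zero_padic_of_hasCM_of_cmRamified W p hCM h5 hram
  obtain ⟨W₁, _, _, -, -, hW₁, g, hg⟩ := RationalPIsogeny.exists_rational_pIsogeny_noPTorsionPadic_of_cmRamified W p hCM h5 hram
  obtain ⟨Φ, -, -, hfix, -, -⟩ := IsogenyLineData.exists_line_clauses_of_isogeny W W₁ p g K hg hW hW₁ κ h𝔭' he' hf'
  have hbot := SchneiderFreeAdditiveX3.fixedPoints_decomp_inf_kerSubgroup_eq_bot_of_noPTorsionPadic W p hW κ 𝔭' h𝔭' he' hf'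
  have hL : ∀ m : (W.baseChange K).geomPrimaryTorsion p,
      (∀ σ ∈ κ.kerSubgroup ⊓ decomp 𝔭', σ • m = m) → p • m = 0 → m = 0 := by
    intro m hm _
    have hmem : m ∈ FixedPoints.addSubgroup ↥(decomp 𝔭' ⊓ κ.kerSubgroup) ((W.baseChange K).geomPrimaryTorsion p) :=
      (FixedPoints.mem_addSubgroup _ _ m).mpr fun d ↦ hm d (by
        obtain ⟨h1, h2⟩ := Subgroup.mem_inf.mp d.2
        exact Subgroup.mem_inf.mpr ⟨h2, h1⟩)
    rw [hbot] at hmem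
    exact (AddSubgroup.mem_bot).mp hmem
  obtain ⟨h1, h2⟩ := htriv Φ hfix
  haveI : Finite (datumStrictSelmer κ.kerSubgroup Φ.Sub p (AcSelmer.bdpData Φ.Sub p 𝔭')
      {v : HeightOneSpectrum (𝓞 K) | ¬ (W.baseChange K).HasGoodReductionAt v ∧ ((p : ℕ) : 𝓞 K) ∉ v.asIdeal}) :=
    Nat.finite_of_card_ne_zero (by rw [h1]; exact one_ne_zero)
  haveI : Finite (datumStrictSelmer κ.kerSubgroup Φ.Quot p (AcSelmer.bdpData Φ.Quot p 𝔭')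
      {v : HeightOneSpectrum (𝓞 K) | ¬ (W.baseChange K).HasGoodReductionAt v ∧ ((p : ℕ) : 𝓞 K) ∉ v.asIdeal}) :=
    Nat.finite_of_card_ne_zero (by rw [h2]; exact one_ne_zero)
  have hΦ : (datumStrictSelmer κ.kerSubgroup Φ.Sub p (AcSelmer.bdpData Φ.Sub p 𝔭')
      {v : HeightOneSpectrum (𝓞 K) | ¬ (W.baseChange K).HasGoodReductionAt v ∧ ((p : ℕ) : 𝓞 K) ∉ v.asIdeal} :
      Set (subgroupH1 κ.kerSubgroup Φ.Sub)).Finite := Set.toFinite _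
  have hΨ : (datumStrictSelmer κ.kerSubgroup Φ.Quot p (AcSelmer.bdpData Φ.Quot p 𝔭')
      {v : HeightOneSpectrum (𝓞 K) | ¬ (W.baseChange K).HasGoodReductionAt v ∧ ((p : ℕ) : 𝓞 K) ∉ v.asIdeal} :
      Set (subgroupH1 κ.kerSubgroup Φ.Quot)).Finite := Set.toFinite _
  have h𝔭dec : ¬ (decomp 𝔭' ≤ κ.kerSubgroup) :=
    ZpExtension.not_decomp_le_kerSubgroup_of_isImaginaryQuadratic hK κ (by exact_mod_cast h𝔭')
  have hSgood : ∀ v : HeightOneSpectrum (𝓞 K),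
      v ∉ {v : HeightOneSpectrum (𝓞 K) | ¬ (W.baseChange K).HasGoodReductionAt v ∧ ((p : ℕ) : 𝓞 K) ∉ v.asIdeal} →
      ((p : ℕ) : 𝓞 K) ∉ v.asIdeal → (W.baseChange K).HasGoodReductionAt v :=
    fun v hv hpv ↦ by by_contra hbad; exact hv ⟨hbad, hpv⟩
  -- `λ = 0`
  have hlam := pow_lambdaInvariant_empty_le_mul_natCard_residualSelmer_of_line (W.baseChange K) p κ 𝔭' γ hp2 h𝔭' h𝔭dec
    hSgood Φ hfix hL hΦ hΨ
  rw [h1, h2, mul_one] at hlam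
  have hlam0 : lambdaInvariant p (XAc (W.baseChange K) p κ 𝔭' ∅ γ) = 0 := by
    by_contra hne0
    have h1le : p ^ 1 ≤ p ^ lambdaInvariant p (XAc (W.baseChange K) p κ 𝔭' ∅ γ) :=
      Nat.pow_le_pow_right hpr.pos (Nat.one_le_iff_ne_zero.mpr hne0)
    have := h1le.trans hlam
    rw [pow_one] at this
    exact absurd this (by omega)
  -- torsion and `μ = 0`
  obtain ⟨htors, hμ⟩ := isTorsion_and_mu_eq_zero_of_line_devissage (W.baseChange K) κ 𝔭' γ h𝔭' h𝔭dec hSgood Φ hfix hΦ hΨ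
  exact hasCharValuationAt_zero_of_isTorsion_of_mu_eq_zero_of_lambda_eq_zero (W.baseChange K) κ 𝔭' Set.finite_empty γ
    htors hμ hlam0

/-- **`BSD_p(W)` ON A REGULAR FRAME for the CM-ramified class, modulo print and ONE number.** `W/ℚ` globally minimal CM,
`p ≥ 5` CM-ramified, `r_an(W) = 1`; ONE Heegner datum `(N, K'', Dt, H, ι, P)` of `W` with `d_{K''}` odd `< −4` and
`L(W^{(d_{K''})}, 1) ≠ 0`; ONE anticyclotomic frame `(κ, γ, 𝔭′ ∋ p)` of `K''` which is REGULAR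
(`XAc.HasCharValuationAt … 0`, e.g. by `hasCharValuationAt_zero_cmRamified_of_trivial_residualSelmer`); and the number
`ord_p log_{ω_W}(P) = v_p(c)` (displayed as two inequalities: `≤` is the Kriz–Li 2019 Thm. 1.20 shape «the normalised `p`-adic
logarithm of the Heegner point is a `p`-adic unit» at an Eisenstein prime under the Bernoulli-unit condition; `≥` is
`log_ω(E(K_𝔭′)) ⊆ ℤ_p` with `p ∤ c`). THEN `BSD_p(W)` — from the citations `ToricPublishedInputs`, Poitou–Tate for Ш,
Burungale–Flach 2024, modularity; control by `additiveControl_heegner_of_cmRamified` (its other four cohomological inputs are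
tree theorems, `prints_four_hold`), twist by `rankZeroTwistBSDp_of_hasCM`, then §1. NO main conjecture, NO `p`-adic
`L`-function. CONDITIONAL; closes nothing; BSD is not proved by any of this.
[cite: KrizLi2019, Thm. 1.20 and Rmk. 1.21 (doi:10.1017/fms.2019.9)] [cite: JetchevSkinnerWan2017, §7.4.1 and Thm. 3.3.1 (arXiv:1512.06894)]
[cite: BurungaleFlach2024, Thm. 1.1 and Cor. 2] [cite: MilneADT2006, Ch. I, Thm. 4.10] -/
theorem bsdp_cmRamified_of_regularFrame_of_padicLogOrd (hF : ToricPublishedInputs)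
    (hPT2 : ∀ (K : Type) [Field K] [NumberField K], poitouTate_sha_tateDual K)
    (hBF : bsdTriple_of_hasCM_of_L_one_ne_zero) (hmod : hasEntireLFunction_rat)
    (W : WeierstrassCurve ℚ) [W.IsElliptic] [W.IsGloballyMinimal] (hCM : W.HasCM) (hram : CMRamified W p) (h5 : 5 ≤ p)
    (hr : W.analyticRank = 1) (N : ℕ) [NeZero N] (K : Type) [Field K] [NumberField K]
    (Dt : ModularParametrizationData W N) (H : HeegnerDatum N (NumberField.discr K)) (ι : K →+* ℂ)
    (P : (W.baseChange K).toAffine.Point) (hN : W.conductorNorm ℤ = N) (hK : IsImaginaryQuadratic K)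
    (hodd : Odd (NumberField.discr K)) (hd4 : NumberField.discr K < -4) (hHH : SatisfiesHeegnerHypothesis N K)
    (hLd : (W.quadraticTwist (NumberField.discr K : ℚ)).entireLFunction 1 ≠ 0)
    (hP : WeierstrassCurve.Affine.Point.map ι.toRatAlgHom P = heegnerPointComplex Dt H)
    (κ : ZpExtension K p) (hκ : κ.IsAnticyclotomic) (γ : absoluteGaloisGroup K) [Fact (κ.IsTopGenerator γ)]
    (𝔭 : HeightOneSpectrum (𝓞 K)) (h𝔭 : ((p : ℕ) : 𝓞 K) ∈ 𝔭.asIdeal) (he : 𝔭.asIdeal.ramificationIdx (𝓞 ℚ) = 1)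
    (hf : 𝔭.asIdeal.inertiaDeg (𝓞 ℚ) = 1)
    (h0 : XAc.HasCharValuationAt (W.baseChange K) p κ 𝔭 ∅ γ 0)
    (hlogle : X11b.padicLogOrd W p (embAt K p 𝔭 h𝔭 he hf) P ≤ (padicValNat p Dt.c.natAbs : ℤ))
    (hlogge : (padicValNat p Dt.c.natAbs : ℤ) ≤ X11b.padicLogOrd W p (embAt K p 𝔭 h𝔭 he hf) P) :
    BSDp W p := by
  have hp2 : p ≠ 2 := by omega
  obtain ⟨hPT, hEP, hcd, hBr⟩ := prints_four_hold
  have hGZ := hF.1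
  have hKo : ∀ (N : ℕ) [NeZero N] (W : WeierstrassCurve ℚ) (K : Type) [Field K] [NumberField K],
      Literature.NumberTheory.EllipticCurves.kolyvagin N W K := hF.2.1
  have hmodF : hasEntireLFunction_rat := hF.2.2.2.1
  have hadd : Addv W p := addv_of_cmRamified W hCM hram h5
  have hpN : p ∣ N := by
    rw [← hN]; exact (W.dvd_conductorNorm_iff_not_hasGoodReductionAtPrime p).mpr hadd.1
  -- non-torsion Heegner point (Gross–Zagier), for control's Kolyvagin antecedent
  have hL0 : W.entireLFunction 1 = 0 := entireLFunction_one_eq_zero_of_analyticRank_eq_one hr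
  obtain ⟨-, hderiv⟩ := leadingLCoeff_eq_deriv_of_analyticRank_eq_one hr
  haveI hN0 : NeZero (W.conductorNorm ℤ) := ⟨W.conductorNorm_pos_holds.ne'⟩
  have hLK : LDerivEK W K ≠ 0 := by
    rw [KrizLi2019.lDerivEK_eq_deriv_mul W K hmodF hL0]; exact mul_ne_zero hderiv hLd
  have hnt : ¬ IsOfFinAddOrder P :=
    (lDerivEK_ne_zero_iff_not_isOfFinAddOrder W N K (hGZ _ W K) hK hHH ⟨Dt, H, ι, hP⟩).mp hLK
  have hctl : SchneiderFree.AdditiveControlOnTreeAt p κ 𝔭 γ (embAt K p 𝔭 h𝔭 he hf) P :=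
    additiveControl_heegner_of_cmRamified hPT hPT2 hEP hcd hBr W hCM hram h5 N K Dt H ι P hN hK hHH hLd hP hnt
      (hKo N W K) κ hκ γ 𝔭 h𝔭 he hf
  -- a globally minimal model of the rank-zero twist and its `BSD_p`
  have hD0 : (NumberField.discr K : ℚ) ≠ 0 := by exact_mod_cast NumberField.discr_ne_zero K
  haveI : (W.quadraticTwist (NumberField.discr K : ℚ)).IsElliptic := W.isElliptic_quadraticTwist hD0
  obtain ⟨Cd, hCd⟩ := hasGlobalMinimalModel_rat_holds (W.quadraticTwist (NumberField.discr K : ℚ))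
  haveI : (Cd • W.quadraticTwist (NumberField.discr K : ℚ)).IsGloballyMinimal := hCd
  have hWd : BSDp (Cd • W.quadraticTwist (NumberField.discr K : ℚ)) p :=
    rankZeroTwistBSDp_of_hasCM hBF hmod W hCM N K (Cd • W.quadraticTwist (NumberField.discr K : ℚ)) hN hK hHH
      ⟨Cd, rfl⟩ hLd
  exact bsdp_of_charValuationZero_of_control_of_padicLogOrd hp2 hF W N K Dt H ι P
    (Cd • W.quadraticTwist (NumberField.discr K : ℚ)) hr hN hpN hK hodd hd4 hHH hLd hP ⟨Cd, rfl⟩ κ γ 𝔭 h𝔭 he hf h0 hctl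
    hlogle hlogge hWd

/-- **The crux's CONCLUSION for `W` ON A REGULAR FRAME** — `X12.O11.RamifiedCMBottomClassIndexLawAtZp W p` (the bottom
elliptic-unit class index law at `ℤ_p` of `PrintCFram.BottomClassIndexLawFiveLe`, for this one `W`) under the crux's own GZK
antecedent, from `bsdp_cmRamified_of_regularFrame_of_padicLogOrd` and k7r-c4's `ramifiedCMBottomClassIndexLawAtZp_of_bsdp`
(+ Cassels). Same displayed hypotheses; CONDITIONAL; the crux (all `W`, all frames) is NOT closed; BSD is not proved by any
of this. [cite: KrizLi2019, Thm. 1.20 and Rmk. 1.21 (doi:10.1017/fms.2019.9)] [cite: Miller2011LMS, Def. 1.1 (arXiv:1010.2431 p. 3)]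
[cite: Cassels1965ArithmeticVIII] -/
theorem ramifiedCMBottomClassIndexLawAtZp_of_regularFrame_of_padicLogOrd (hF : ToricPublishedInputs)
    (hPT2 : ∀ (K : Type) [Field K] [NumberField K], poitouTate_sha_tateDual K)
    (hBF : bsdTriple_of_hasCM_of_L_one_ne_zero) (hmod : hasEntireLFunction_rat) (hCassels : bsdRHS_eq_of_isIsogenous)
    (hGZK : rank_eq_analyticRank_of_analyticRank_le_one)
    (W : WeierstrassCurve ℚ) [W.IsElliptic] [W.IsGloballyMinimal] (hCM : W.HasCM) (hram : CMRamified W p) (h5 : 5 ≤ p)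
    (hr : W.analyticRank = 1) (N : ℕ) [NeZero N] (K : Type) [Field K] [NumberField K]
    (Dt : ModularParametrizationData W N) (H : HeegnerDatum N (NumberField.discr K)) (ι : K →+* ℂ)
    (P : (W.baseChange K).toAffine.Point) (hN : W.conductorNorm ℤ = N) (hK : IsImaginaryQuadratic K)
    (hodd : Odd (NumberField.discr K)) (hd4 : NumberField.discr K < -4) (hHH : SatisfiesHeegnerHypothesis N K)
    (hLd : (W.quadraticTwist (NumberField.discr K : ℚ)).entireLFunction 1 ≠ 0)
    (hP : WeierstrassCurve.Affine.Point.map ι.toRatAlgHom P = heegnerPointComplex Dt H)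
    (κ : ZpExtension K p) (hκ : κ.IsAnticyclotomic) (γ : absoluteGaloisGroup K) [Fact (κ.IsTopGenerator γ)]
    (𝔭 : HeightOneSpectrum (𝓞 K)) (h𝔭 : ((p : ℕ) : 𝓞 K) ∈ 𝔭.asIdeal) (he : 𝔭.asIdeal.ramificationIdx (𝓞 ℚ) = 1)
    (hf : 𝔭.asIdeal.inertiaDeg (𝓞 ℚ) = 1)
    (h0 : XAc.HasCharValuationAt (W.baseChange K) p κ 𝔭 ∅ γ 0)
    (hlogle : X11b.padicLogOrd W p (embAt K p 𝔭 h𝔭 he hf) P ≤ (padicValNat p Dt.c.natAbs : ℤ))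
    (hlogge : (padicValNat p Dt.c.natAbs : ℤ) ≤ X11b.padicLogOrd W p (embAt K p 𝔭 h𝔭 he hf) P) :
    X12.O11.RamifiedCMBottomClassIndexLawAtZp W p :=
  RubinFormulaZpBsdp.ramifiedCMBottomClassIndexLawAtZp_of_bsdp hCassels hmod hGZK hr.le
    (bsdp_cmRamified_of_regularFrame_of_padicLogOrd hF hPT2 hBF hmod W hCM hram h5 hr N K Dt H ι P hN hK hodd hd4 hHH
      hLd hP κ hκ γ 𝔭 h𝔭 he hf h0 hlogle hlogge)

/-- **The crux's CONCLUSION for `W` from TRIVIAL character residual Selmer groups and ONE number** — the two §2 steps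
composed: for `W` CM, `p ≥ 5` CM-ramified, `r_an = 1`, ONE Heegner datum `(K'', P)` (`d_{K''}` odd `< −4`, `L(W^{(d)},1) ≠ 0`) and
ONE anticyclotomic frame `(κ, γ, 𝔭′)` of `K''` at which every residual line with the local clause has trivial residual Selmer
groups (the «relative `p`-class numbers trivial» locus) and `ord_p log_{ω_W}(P) = v_p(c)`: `RamifiedCMBottomClassIndexLawAtZp W p`,
modulo `ToricPublishedInputs`, Poitou–Tate for Ш, Burungale–Flach, modularity, Cassels, GZK. NO main conjecture, NO `p`-adic
`L`-function, NO CGLS Prop. 14. CONDITIONAL; the crux is NOT closed; BSD is not proved by any of this.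
[cite: KrizLi2019, Thm. 1.20, Rmk. 1.21 and p. 3 (doi:10.1017/fms.2019.9)] [cite: CastellaGrossiLeeSkinner2022, §3 (arXiv:2008.02571)]
[cite: Miller2011LMS, Def. 1.1 (arXiv:1010.2431 p. 3)] -/
theorem ramifiedCMBottomClassIndexLawAtZp_of_trivial_residualSelmer_of_padicLogOrd (hF : ToricPublishedInputs)
    (hPT2 : ∀ (K : Type) [Field K] [NumberField K], poitouTate_sha_tateDual K)
    (hBF : bsdTriple_of_hasCM_of_L_one_ne_zero) (hmod : hasEntireLFunction_rat) (hCassels : bsdRHS_eq_of_isIsogenous)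
    (hGZK : rank_eq_analyticRank_of_analyticRank_le_one)
    (W : WeierstrassCurve ℚ) [W.IsElliptic] [W.IsGloballyMinimal] (hCM : W.HasCM) (hram : CMRamified W p) (h5 : 5 ≤ p)
    (hr : W.analyticRank = 1) (N : ℕ) [NeZero N] (K : Type) [Field K] [NumberField K]
    (Dt : ModularParametrizationData W N) (H : HeegnerDatum N (NumberField.discr K)) (ι : K →+* ℂ)
    (P : (W.baseChange K).toAffine.Point) (hN : W.conductorNorm ℤ = N) (hK : IsImaginaryQuadratic K)
    (hodd : Odd (NumberField.discr K)) (hd4 : NumberField.discr K < -4) (hHH : SatisfiesHeegnerHypothesis N K)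
    (hLd : (W.quadraticTwist (NumberField.discr K : ℚ)).entireLFunction 1 ≠ 0)
    (hP : WeierstrassCurve.Affine.Point.map ι.toRatAlgHom P = heegnerPointComplex Dt H)
    (κ : ZpExtension K p) (hκ : κ.IsAnticyclotomic) (γ : absoluteGaloisGroup K) [Fact (κ.IsTopGenerator γ)]
    (𝔭 : HeightOneSpectrum (𝓞 K)) (h𝔭 : ((p : ℕ) : 𝓞 K) ∈ 𝔭.asIdeal) (he : 𝔭.asIdeal.ramificationIdx (𝓞 ℚ) = 1)
    (hf : 𝔭.asIdeal.inertiaDeg (𝓞 ℚ) = 1)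
    (htriv : ∀ (Φ : X2.ResidualDevissageModules.StableSubgroup (absoluteGaloisGroup K) ((W.baseChange K).geomTorsion (p : ℤ))),
      (∀ y : Φ.Quot, (∀ g : ↥(κ.kerSubgroup ⊓ decomp 𝔭), g • y = y) → y = 0) →
      Nat.card (datumStrictSelmer κ.kerSubgroup Φ.Sub p (AcSelmer.bdpData Φ.Sub p 𝔭)
          {v : HeightOneSpectrum (𝓞 K) | ¬ (W.baseChange K).HasGoodReductionAt v ∧ ((p : ℕ) : 𝓞 K) ∉ v.asIdeal}) = 1 ∧
      Nat.card (datumStrictSelmer κ.kerSubgroup Φ.Quot p (AcSelmer.bdpData Φ.Quot p 𝔭)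
          {v : HeightOneSpectrum (𝓞 K) | ¬ (W.baseChange K).HasGoodReductionAt v ∧ ((p : ℕ) : 𝓞 K) ∉ v.asIdeal}) = 1)
    (hlogle : X11b.padicLogOrd W p (embAt K p 𝔭 h𝔭 he hf) P ≤ (padicValNat p Dt.c.natAbs : ℤ))
    (hlogge : (padicValNat p Dt.c.natAbs : ℤ) ≤ X11b.padicLogOrd W p (embAt K p 𝔭 h𝔭 he hf) P) :
    X12.O11.RamifiedCMBottomClassIndexLawAtZp W p :=
  ramifiedCMBottomClassIndexLawAtZp_of_regularFrame_of_padicLogOrd hF hPT2 hBF hmod hCassels hGZK W hCM hram h5 hr N K Dt H ι P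
    hN hK hodd hd4 hHH hLd hP κ hκ γ 𝔭 h𝔭 he hf
    (hasCharValuationAt_zero_cmRamified_of_trivial_residualSelmer W hCM hram h5 hN hK hHH κ γ 𝔭 h𝔭 htriv) hlogle hlogge

end CMRamified

end Summit.BirchSwinnertonDyer.BirchSwinnertonDyer.Theorems.PrintCFram.EisensteinRegularLocus

end
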